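import Summits.Ventures.HodgeRepro2.T5SchurIntertwiner
import Summits.Ventures.HodgeRepro2.T5SchurIff
import Mathlib.Analysis.InnerProductSpace.Subspace

/-!
# T5SchurIsotypicCopy — closed stable subspaces of an isotypic Hilbert sum contain a copy of the irreducible

Cell pub-hodge-repro2, seat p5, Tier 5 (route/T5-N4-p5.md, N4.3 (A3) STEP 3 (δ) and STEP 4,
l. 147).  The prose (δ) says: «L_π is a Hilbert sum of copies of π, and so is every closed
G_∞-invariant subspace of L_π», and STEP 4 uses it to place π₀ in a single isotypic part.  The
second half of (δ) was argued in print with the commutant B(ℓ²(I)) ⊗ I («blockwise Schur»); this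
file proves the part of it that STEP 4 actually consumes WITHOUT any commutant computation, from
[Bo72] 5.4–5.5 alone (T5SchurIff, T5SchurIntertwiner):

* `exists_starProjection_ne_zero`: a non-zero vector of the closed span of closed subspaces `H i`
  has a non-zero orthogonal projection to some `H i`;
* `star_eq_of_coe_eq`: a representation `ρW` on a closed `ρ`-stable subspace `W` that agrees with
  `ρ` («the restriction of `ρ` to `W`») is unitary when `ρ` is;
* `exists_intertwiner_ne_zero`, `exists_copy` (the lemma): let `ρ` be a unitary representation on
  the Hilbert space `E`, `σ` an irreducible unitary representation on `F`, `H i` closed `ρ`-stable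
  subspaces each unitarily equivalent to `σ` (`U i : F ≃ₗᵢ[ℂ] H i` intertwining), and `W ≠ ⊥` a
  closed `ρ`-stable subspace of the closed span of the `H i`, carrying the restriction `ρW`.  Then
  `W` contains a closed `ρW`-stable subspace `C` with a unitary equivalence `F ≃ₗᵢ[ℂ] C` intertwining
  `σ` and `ρW` — «W contains a copy of π».  Proof: some coordinate projection `P_i` is non-zero on
  `W`; `A := U_i⁻¹ ∘ P_i|_W : W → F` is a non-zero intertwiner, so its adjoint `A† : F → W` is a
  non-zero intertwiner OUT OF the irreducible `σ` (`exists_intertwiner_ne_zero`), and 5.5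
  (`T5SchurIntertwiner.exists_linearIsometryEquiv_range`) realises `σ` on the closed stable
  subspace `range A†` of `W`;
* `exists_linearIsometryEquiv_of_irreducible`: if moreover `ρW` is irreducible, `ρW ≅ σ` — the
  uniqueness input of STEP 4 («a copy of π inside a Hilbert sum of copies of π′ forces π ≅ π′»).

No pairwise orthogonality of the `H i` is needed.  Mathlib only besides the two p5 files.
Axioms: propext, Classical.choice, Quot.sound.
-/

namespace Summit.Ventures.HodgeRepro2.T5SchurIsotypicCopy

open ContinuousLinearMap
open scoped InnerProductSpace

variable {E F : Type*} [NormedAddCommGroup E] [InnerProductSpace ℂ E] [CompleteSpace E]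
  [NormedAddCommGroup F] [InnerProductSpace ℂ F] [CompleteSpace F]
variable {G : Type*} [Group G]

/-- A non-zero vector of the closed span of closed subspaces `H i` has a non-zero orthogonal
projection to some `H i`. -/
theorem exists_starProjection_ne_zero {ι : Type*} (H : ι → Submodule ℂ E)
    (hHc : ∀ i, IsClosed (H i : Set E)) {w : E} (hwm : w ∈ (⨆ i, H i).topologicalClosure)
    (hw : w ≠ 0) : ∃ i, (H i).starProjection w ≠ 0 := by
  by_contra h
  have hall : ∀ i, w ∈ (H i)ᗮ := fun i => by
    haveI : CompleteSpace (H i) := (hHc i).completeSpace_coe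
    exact (Submodule.starProjection_apply_eq_zero_iff (H i)).mp (not_not.mp (not_exists.mp h i))
  have hmem : w ∈ (⨆ i, H i)ᗮ := by
    rw [← Submodule.iInf_orthogonal, Submodule.mem_iInf]
    exact hall
  rw [← Submodule.orthogonal_closure] at hmem
  have hboth : w ∈ (⨆ i, H i).topologicalClosure ⊓ ((⨆ i, H i).topologicalClosure)ᗮ := ⟨hwm, hmem⟩
  rw [Submodule.inf_orthogonal_eq_bot, Submodule.mem_bot] at hboth
  exact hw hboth

omit [CompleteSpace F] in
/-- A representation `ρW` on a subspace `W` that agrees with the unitary `ρ` is unitary. -/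
theorem star_eq_of_coe_eq {ρ : G →* (E →L[ℂ] E)} (hρ : ∀ g, star (ρ g) = ρ g⁻¹)
    {W : Submodule ℂ E} (hWc : IsClosed (W : Set E)) (ρW : G →* (W →L[ℂ] W))
    (hρW : ∀ g (w : W), (ρW g w : E) = ρ g w) (g : G) : star (ρW g) = ρW g⁻¹ := by
  haveI : CompleteSpace W := hWc.completeSpace_coe
  rw [star_eq_adjoint]
  symm
  rw [eq_adjoint_iff]
  intro x y
  rw [Submodule.coe_inner, Submodule.coe_inner, hρW, hρW, ← adjoint_inner_left,
    ← star_eq_adjoint, hρ]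

omit [CompleteSpace E] [CompleteSpace F] in
/-- The inverse of an intertwining unitary equivalence `U : F ≃ₗᵢ[ℂ] H` intertwines back:
`σ g (U⁻¹ z) = U⁻¹ (ρ g z)` for `z ∈ H`. -/
theorem symm_apply_eq {ρ : G →* (E →L[ℂ] E)} {σ : G →* (F →L[ℂ] F)} {H : Submodule ℂ E}
    (hHs : ∀ g, ∀ x ∈ H, ρ g x ∈ H) (U : F ≃ₗᵢ[ℂ] H)
    (hU : ∀ g x, (U (σ g x) : E) = ρ g (U x)) (g : G) (z : H) :
    σ g (U.symm z) = U.symm ⟨ρ g z, hHs g z z.2⟩ := by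
  have h1 : U (σ g (U.symm z)) = ⟨ρ g z, hHs g z z.2⟩ := by
    apply Subtype.ext
    rw [hU, LinearIsometryEquiv.apply_symm_apply]
  rw [← h1, LinearIsometryEquiv.symm_apply_apply]

/-- **A non-zero closed stable subspace of a Hilbert sum of copies of `σ` receives a non-zero
intertwiner from `σ`.**  `ρ` unitary on `E`; `σ` unitary on `F`; `H i` closed `ρ`-stable, each
unitarily `σ` via `U i`; `W ≠ ⊥` a closed `ρ`-stable subspace of the closed span of the `H i`, with
restriction `ρW`.  Then there is a non-zero `T : F →L[ℂ] W` intertwining `σ` with `ρW` — the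
adjoint of `U_i⁻¹ ∘ P_i|_W` for a coordinate projection `P_i` that is non-zero on `W`. -/
theorem exists_intertwiner_ne_zero {ρ : G →* (E →L[ℂ] E)} (hρ : ∀ g, star (ρ g) = ρ g⁻¹)
    {σ : G →* (F →L[ℂ] F)} (hσ : ∀ g, star (σ g) = σ g⁻¹)
    {ι : Type*} (H : ι → Submodule ℂ E) (hHc : ∀ i, IsClosed (H i : Set E))
    (hHs : ∀ i g, ∀ x ∈ H i, ρ g x ∈ H i)
    (U : ∀ i, F ≃ₗᵢ[ℂ] H i) (hU : ∀ i g x, ((U i) (σ g x) : E) = ρ g (U i x))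
    {W : Submodule ℂ E} (hWc : IsClosed (W : Set E)) (hWle : W ≤ (⨆ i, H i).topologicalClosure)
    (hW0 : W ≠ ⊥) (ρW : G →* (W →L[ℂ] W)) (hρW : ∀ g (w : W), (ρW g w : E) = ρ g w) :
    ∃ T : F →L[ℂ] W, T ≠ 0 ∧ ∀ g, T ∘L σ g = ρW g ∘L T := by
  haveI : CompleteSpace W := hWc.completeSpace_coe
  have hρW' : ∀ g, star (ρW g) = ρW g⁻¹ := star_eq_of_coe_eq hρ hWc ρW hρW
  -- a vector of `W` with a non-zero coordinate projection
  obtain ⟨w, hwW, hw0⟩ := (Submodule.ne_bot_iff W).mp hW0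
  obtain ⟨i, hi⟩ := exists_starProjection_ne_zero H hHc (hWle hwW) hw0
  haveI : CompleteSpace (H i) := (hHc i).completeSpace_coe
  -- the intertwiner `A = U_i⁻¹ ∘ P_i|_W : W → F`
  let P : W →L[ℂ] H i :=
    (H i).starProjection.restrict fun x _ => (H i).starProjection_apply_mem x
  let A : W →L[ℂ] F := (U i).symm.toLinearIsometry.toContinuousLinearMap ∘L P
  have hA : ∀ g, A ∘L ρW g = σ g ∘L A := by
    intro g
    ext x
    simp only [A, P, comp_apply, LinearIsometry.coe_toContinuousLinearMap,
      LinearIsometryEquiv.coe_toLinearIsometry, restrict_apply]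
    have hcomm := DFunLike.congr_fun (T5SchurIff.starProjection_comm hρ (hHc i) (hHs i) g) (x : E)
    simp only [comp_apply] at hcomm
    rw [symm_apply_eq (hHs i) (U i) (hU i) g]
    congr 1
    apply Subtype.ext
    simp only [hρW]
    exact hcomm
  have hA0 : A ≠ 0 := by
    intro h
    have hx := DFunLike.congr_fun h ⟨w, hwW⟩
    simp only [A, P, comp_apply, LinearIsometry.coe_toContinuousLinearMap,
      LinearIsometryEquiv.coe_toLinearIsometry, restrict_apply, zero_apply,
      LinearIsometryEquiv.map_eq_zero_iff] at hx
    exact hi (congrArg Subtype.val hx)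
  -- its adjoint intertwines `σ` into `ρW` and is non-zero
  refine ⟨adjoint A, ?_, T5SchurIntertwiner.adjoint_comp_eq_of_intertwines hρW' hσ hA⟩
  intro h
  apply hA0
  have := congrArg (fun T => adjoint T) h
  simpa only [adjoint_adjoint, map_zero] using this

/-- **A closed stable subspace of a Hilbert sum of copies of an irreducible `σ` contains a copy of
`σ`.**  `ρ` unitary on `E`; `σ` irreducible unitary on `F`; `H i` closed `ρ`-stable, each unitarily
`σ` via `U i`; `W ≠ ⊥` a closed `ρ`-stable subspace of the closed span of the `H i`, with restriction
`ρW`.  Then some closed `ρW`-stable `C ≤ W` carries a unitary equivalence `F ≃ₗᵢ[ℂ] C` intertwining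
`σ` with `ρW` ([Bo72] 5.5 applied to the intertwiner of `exists_intertwiner_ne_zero`). -/
theorem exists_copy {ρ : G →* (E →L[ℂ] E)} (hρ : ∀ g, star (ρ g) = ρ g⁻¹)
    {σ : G →* (F →L[ℂ] F)} (hσ : ∀ g, star (σ g) = σ g⁻¹)
    (hσirr : ∀ V : Submodule ℂ F, IsClosed (V : Set F) →
      (∀ g, ∀ v ∈ V, σ g v ∈ V) → V = ⊥ ∨ V = ⊤)
    {ι : Type*} (H : ι → Submodule ℂ E) (hHc : ∀ i, IsClosed (H i : Set E))
    (hHs : ∀ i g, ∀ x ∈ H i, ρ g x ∈ H i)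
    (U : ∀ i, F ≃ₗᵢ[ℂ] H i) (hU : ∀ i g x, ((U i) (σ g x) : E) = ρ g (U i x))
    {W : Submodule ℂ E} (hWc : IsClosed (W : Set E)) (hWle : W ≤ (⨆ i, H i).topologicalClosure)
    (hW0 : W ≠ ⊥) (ρW : G →* (W →L[ℂ] W)) (hρW : ∀ g (w : W), (ρW g w : E) = ρ g w) :
    ∃ C : Submodule ℂ W, IsClosed (C : Set W) ∧ (∀ g, ∀ x ∈ C, ρW g x ∈ C) ∧
      ∃ V : F ≃ₗᵢ[ℂ] C, ∀ g x, (V (σ g x) : W) = ρW g (V x) := by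
  haveI : CompleteSpace W := hWc.completeSpace_coe
  have hρW' : ∀ g, star (ρW g) = ρW g⁻¹ := star_eq_of_coe_eq hρ hWc ρW hρW
  obtain ⟨B, hB0, hB⟩ := exists_intertwiner_ne_zero hρ hσ H hHc hHs U hU hWc hWle hW0 ρW hρW
  obtain ⟨t, V, ht, -, hV⟩ :=
    T5SchurIntertwiner.exists_linearIsometryEquiv_range hσ hρW' hσirr hB hB0
  obtain ⟨t₀, ht₀, hBt₀⟩ :=
    T5SchurIntertwiner.exists_pos_adjoint_comp_self_eq_smul_one hσ hρW' hσirr hB hB0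
  exact ⟨LinearMap.range (B : F →ₗ[ℂ] W),
    T5SchurIntertwiner.isClosed_range_coe ht₀ hBt₀, T5SchurIntertwiner.range_stable hB, V, hV⟩

/-- **Uniqueness input of STEP 4.**  If in addition the restriction `ρW` is irreducible (and `F` is
non-trivial), then `ρW` is unitarily equivalent to `σ`: a copy of an irreducible inside a Hilbert
sum of copies of `σ` is a copy of `σ`. -/
theorem exists_linearIsometryEquiv_of_irreducible [Nontrivial F]
    {ρ : G →* (E →L[ℂ] E)} (hρ : ∀ g, star (ρ g) = ρ g⁻¹)
    {σ : G →* (F →L[ℂ] F)} (hσ : ∀ g, star (σ g) = σ g⁻¹)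
    (hσirr : ∀ V : Submodule ℂ F, IsClosed (V : Set F) →
      (∀ g, ∀ v ∈ V, σ g v ∈ V) → V = ⊥ ∨ V = ⊤)
    {ι : Type*} (H : ι → Submodule ℂ E) (hHc : ∀ i, IsClosed (H i : Set E))
    (hHs : ∀ i g, ∀ x ∈ H i, ρ g x ∈ H i)
    (U : ∀ i, F ≃ₗᵢ[ℂ] H i) (hU : ∀ i g x, ((U i) (σ g x) : E) = ρ g (U i x))
    {W : Submodule ℂ E} (hWc : IsClosed (W : Set E)) (hWle : W ≤ (⨆ i, H i).topologicalClosure)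
    (hW0 : W ≠ ⊥) (ρW : G →* (W →L[ℂ] W)) (hρW : ∀ g (w : W), (ρW g w : E) = ρ g w)
    (hWirr : ∀ C : Submodule ℂ W, IsClosed (C : Set W) →
      (∀ g, ∀ x ∈ C, ρW g x ∈ C) → C = ⊥ ∨ C = ⊤) :
    ∃ V : F ≃ₗᵢ[ℂ] W, ∀ g x, (V (σ g x) : E) = ρ g (V x) := by
  obtain ⟨C, hCc, hCs, V, hV⟩ :=
    exists_copy hρ hσ hσirr H hHc hHs U hU hWc hWle hW0 ρW hρW
  have hC : C = ⊤ := by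
    rcases hWirr C hCc hCs with hbot | htop
    · exfalso
      obtain ⟨x, hx⟩ := exists_ne (0 : F)
      haveI : Subsingleton C := Submodule.subsingleton_iff_eq_bot.mpr hbot
      exact hx (V.injective (Subsingleton.elim _ _))
    · exact htop
  refine ⟨V.trans (LinearIsometryEquiv.ofTop W C hC), fun g x => ?_⟩
  rw [LinearIsometryEquiv.trans_apply, LinearIsometryEquiv.trans_apply,
    LinearIsometryEquiv.ofTop_apply, LinearIsometryEquiv.ofTop_apply, hV, hρW]

end Summit.Ventures.HodgeRepro2.T5SchurIsotypicCopy
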